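import Mathlib.RepresentationTheory.Basic
import Mathlib.LinearAlgebra.FiniteDimensional.Lemmas
import Mathlib.Tactic.NoncommRing
import HarnessLib

/-!
# No free action of `(ℤ/5)²` on a non-zero vector space (cell `hodge-kum4`, seat p2; kernel lemma for (H2))

HONEST FRAMING.  Pure linear algebra; nothing about `K⁴(A)` or the Hodge conjecture is proved here.
It is the kernel half of the derivation of the TRANSITIVITY (H2) of `Γ(K⁴(A))` on the fixed points of
each `g ∈ Γ ∖ 1` from print: at a `g`-fixed point `x` with stabiliser `Γ_x ⊋ ⟨g⟩` the tangent space
`T = T_x K ≠ 0` would carry two commuting operators `a = dg`, `b = dγ` of order `5`, `γ ∉ ⟨g⟩`, with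
`T^δ = 0` for every `δ = g^i γ^j ≠ 1` (all of them have isolated fixed points); the lemma below says
this is impossible.

**Lemma.**  Let `a, b` be commuting endomorphisms of a vector space `V` over a field with `5 ≠ 0`,
`a⁵ = b⁵ = 1`, such that `a^i b^j` has no non-zero fixed vector for `(i, j) ≠ (0, 0)`, `i, j < 5`.  Then
`V = 0`.  *Proof.*  For `δ⁵ = 1` without fixed vectors, `S(δ) = 1 + δ + δ² + δ³ + δ⁴ = 0`
(`δ S(δ) = S(δ)`).  Summing `S(a bʲ)` over `j = 0, …, 4` and regrouping by powers of `a` gives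
`5 + (a + a² + a³ + a⁴) S(b) = 5`, so `5 = 0` on `V`.  ∎
-/

namespace Summit.Ventures.HodgeKum4

namespace RankTwo

variable {F V : Type*} [Field F] [AddCommGroup V] [Module F V]

/-- If `δ⁵ = 1` and `δ` has no non-zero fixed vector, then `1 + δ + δ² + δ³ + δ⁴ = 0`. -/
theorem geomSum_eq_zero (δ : Module.End F V) (h5 : δ ^ 5 = 1) (hfree : ∀ v, δ v = v → v = 0) :
    1 + δ + δ ^ 2 + δ ^ 3 + δ ^ 4 = 0 := by
  set S : Module.End F V := 1 + δ + δ ^ 2 + δ ^ 3 + δ ^ 4 with hS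
  have hδS : δ * S = S := by
    have h : δ * S = δ + δ ^ 2 + δ ^ 3 + δ ^ 4 + δ ^ 5 := by rw [hS]; noncomm_ring
    rw [h, h5, hS]
    abel
  ext v
  simp only [LinearMap.zero_apply]
  apply hfree
  have := congrArg (fun f : Module.End F V => f v) hδS
  simpa [Module.End.mul_apply] using this

/-- Powers of an element of order dividing `5` reduce modulo `5`. -/
theorem pow_eq_pow_mod (b : Module.End F V) (h5 : b ^ 5 = 1) (n : ℕ) : b ^ n = b ^ (n % 5) := by
  conv_lhs => rw [← Nat.div_add_mod n 5, pow_add, pow_mul, h5, one_pow, one_mul]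

/-- **No free linear action of `(ℤ/5)²`.**  Commuting `a, b` with `a⁵ = b⁵ = 1` such that every
`aⁱ bʲ ≠ 1` (`(i, j) ≠ (0, 0)`, `i, j < 5`) is fixed-point free force `V = 0` (`5 ≠ 0` in `F`). -/
theorem eq_zero_of_free (h5F : (5 : F) ≠ 0) (a b : Module.End F V) (hab : Commute a b)
    (ha : a ^ 5 = 1) (hb : b ^ 5 = 1)
    (hfree : ∀ i j : ℕ, i < 5 → j < 5 → ¬ (i = 0 ∧ j = 0) → ∀ v, (a ^ i * b ^ j) v = v → v = 0)
    (v : V) : v = 0 := by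
  -- `S(b) = 0`
  have hSb : 1 + b + b ^ 2 + b ^ 3 + b ^ 4 = 0 :=
    geomSum_eq_zero b hb fun w hw => hfree 0 1 (by norm_num) (by norm_num) (by norm_num) w
      (by simpa using hw)
  -- `S(a bʲ) = 0` for `j < 5`, with `(a bʲ)^k = a^k b^{jk}`
  have hT : ∀ j : ℕ, j < 5 →
      1 + a * b ^ j + a ^ 2 * b ^ (2 * j) + a ^ 3 * b ^ (3 * j) + a ^ 4 * b ^ (4 * j) = 0 := by
    intro j hj
    have hc : Commute a (b ^ j) := hab.pow_right j
    have h := geomSum_eq_zero (a * b ^ j) (by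
        rw [hc.mul_pow, ha, one_mul, ← pow_mul, mul_comm, pow_mul, hb, one_pow])
      (fun w hw => hfree 1 j (by norm_num) hj (by omega) w (by simpa using hw))
    have e : ∀ k : ℕ, (a * b ^ j) ^ k = a ^ k * b ^ (k * j) := fun k => by
      rw [hc.mul_pow, ← pow_mul, mul_comm j k]
    rw [e 2, e 3, e 4] at h
    simpa [pow_one] using h
  -- reduce the exponents modulo `5` and add up
  have h0 := hT 0 (by norm_num)
  have h1 := hT 1 (by norm_num)
  have h2 := hT 2 (by norm_num)
  have h3 := hT 3 (by norm_num)
  have h4 := hT 4 (by norm_num)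
  norm_num at h0 h1 h2 h3 h4
  rw [pow_eq_pow_mod b hb 6, pow_eq_pow_mod b hb 8] at h2
  rw [pow_eq_pow_mod b hb 6, pow_eq_pow_mod b hb 9, pow_eq_pow_mod b hb 12] at h3
  rw [pow_eq_pow_mod b hb 8, pow_eq_pow_mod b hb 12, pow_eq_pow_mod b hb 16] at h4
  norm_num at h2 h3 h4
  -- the identity `Σ_j S(a bʲ) = 5 + (a + a² + a³ + a⁴) S(b)`
  have key : (1 + 1 + 1 + 1 + 1 : Module.End F V) =
      (1 + a + a ^ 2 + a ^ 3 + a ^ 4) +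
      (1 + a * b + a ^ 2 * b ^ 2 + a ^ 3 * b ^ 3 + a ^ 4 * b ^ 4) +
      (1 + a * b ^ 2 + a ^ 2 * b ^ 4 + a ^ 3 * b + a ^ 4 * b ^ 3) +
      (1 + a * b ^ 3 + a ^ 2 * b + a ^ 3 * b ^ 4 + a ^ 4 * b ^ 2) +
      (1 + a * b ^ 4 + a ^ 2 * b ^ 3 + a ^ 3 * b ^ 2 + a ^ 4 * b) -
      (a + a ^ 2 + a ^ 3 + a ^ 4) * (1 + b + b ^ 2 + b ^ 3 + b ^ 4) := by
    noncomm_ring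
  rw [h0, h1, h2, h3, h4, hSb, mul_zero] at key
  simp only [add_zero, sub_zero] at key
  -- `5 = 0` on `V`
  have h5v : (5 : F) • v = 0 := by
    have h := congrArg (fun f : Module.End F V => f v) key
    simp only [LinearMap.add_apply, Module.End.one_apply, LinearMap.zero_apply] at h
    rw [show (5 : F) = 1 + 1 + 1 + 1 + 1 by norm_num]
    simp only [add_smul, one_smul]
    exact h
  exact (smul_eq_zero.1 h5v).resolve_left h5F

end RankTwo

end Summit.Ventures.HodgeKum4
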